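import Literature.Computability.Complexity.ACFourierTails
import Literature.Computability.Complexity.CircuitRestriction
import Literature.Computability.Complexity.CircuitInputMap
import Summits.PneNP.PneNP.Theorems.OneSliceSliceACZeroDefs

/-!
# Route OneSlice, item `ShallowSliceBound` (stmt-PneNP-14083): total pivotality of shallow circuits

Helper file (prover seat, 2026-08-16) for `Theorems/OneSliceShallowSliceBound.lean`, stated over the landed
vocabulary only (`upPivotal f` of `Theorems/OneSliceSliceACZeroDefs.lean`: the pivotal UP-edges `(x, i)`,
`x_i = 0`, `f x ≠ f (x with x_i := 1)`; no new definition). For a Boolean function `G` on a finite cube,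
`2 · #upPivotal G = Σ_i #{z : G(z|ᵢ₌₀) ≠ G(z|ᵢ₌₁)}` is the un-normalised total influence `2^m · I[G]`. We prove

* `sum_card_piv_eq_sum_tailWeight` / `two_mul_card_upPivotal_eq` — the Fourier identity
  `2^m · I[G] = 2^m Σ_{d<m} W^{≥ d+1}[sgn ∘ G]` (O'Donnell 2014, `I[f] = Σ_S |S| f̂(S)² = Σ_k W^{≥k}[f]`), from the
  tree's `sum_tailWeight_piecewise`, Parseval and Abel summation (`FourierTails.lean`);
* `two_mul_card_upPivotal_circuit_le` — for a circuit over `acBasis` on `Fin m` of `acDepth ≤ d` and `≤ s`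
  gates (`s ≥ 1`), `2 · #upPivotal ≤ 2^m · A^{d+2} B^{d+2} ℓ^{d} / log 2`, `ℓ = logM (2s)` (Tal's exponentially
  small Fourier tails `ACForm.tailWeight_le_tailBound` summed geometrically — Boppana's
  `I[f] = O((log s)^{d-1})`-type bound with the tree's constants `A = ACForm.cA`, `B = ACForm.cB`);
* `two_mul_card_upPivotal_restrict_le` — the same bound for the restriction `y ↦ D(y ∧ 1_T)` of a circuit `D`
  over `acBasis` on any finite cube (`Circuit.exists_restrict` + `Circuit.mapInputs`).
-/

set_option linter.dupNamespace false

noncomputable section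

namespace Summit.PneNP.PneNP.Theorems.ShallowSliceBound

open Finset Literature.Computability.Complexity Literature.Computability.Complexity.LowDegree
open Literature.Probability.RandomGraphs.LowDegree (sgn walsh sgn_true sgn_false)
open Summit.PneNP.PneNP.Cruxes.SliceACZero.RussoWindowLadder (upPivotal)

/-! ### Pivotal pairs -/

section Piv

variable {κ : Type} [Fintype κ] [DecidableEq κ]

/-- Membership in the set of pivotal UP-edges. [folklore] -/
theorem mem_upPivotal_iff {G : (κ → Bool) → Bool} {p : (κ → Bool) × κ} :
    p ∈ upPivotal G ↔ p.1 p.2 = false ∧ G p.1 ≠ G (Function.update p.1 p.2 true) := by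
  simp [upPivotal]

/-- Each pivotal coordinate-`i` point set splits into its lower and upper endpoints:
`#{z : G(z|ᵢ₌₀) ≠ G(z|ᵢ₌₁)} = 2 · #{z : z i = 0, G z ≠ G(z|ᵢ₌₁)}`. [folklore] -/
theorem card_piv_eq_two_mul (G : (κ → Bool) → Bool) (i : κ) :
    #(univ.filter fun z : κ → Bool => G (Function.update z i false) ≠ G (Function.update z i true)) =
      2 * #(univ.filter fun z : κ → Bool => z i = false ∧ G z ≠ G (Function.update z i true)) := by
  set P := univ.filter fun z : κ → Bool => G (Function.update z i false) ≠ G (Function.update z i true)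
    with hP
  set L := univ.filter fun z : κ → Bool => z i = false ∧ G z ≠ G (Function.update z i true) with hL
  have hsplit := Finset.card_filter_add_card_filter_not (s := P) (fun z => z i = false)
  have h1 : P.filter (fun z => z i = false) = L := by
    ext z
    simp only [hP, hL, mem_filter, mem_univ, true_and]
    constructor
    · rintro ⟨h, hz⟩
      refine ⟨hz, ?_⟩
      have : Function.update z i false = z := by
        rw [← hz]; exact Function.update_eq_self i z
      rwa [this] at h
    · rintro ⟨hz, h⟩
      refine ⟨?_, hz⟩
      have : Function.update z i false = z := by
        rw [← hz]; exact Function.update_eq_self i z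
      rwa [this]
  have h2 : #(P.filter fun z => ¬ z i = false) = #L := by
    refine Finset.card_bij' (fun z _ => Function.update z i false) (fun z _ => Function.update z i true)
      ?_ ?_ ?_ ?_
    · intro z hz
      simp only [hP, mem_filter, mem_univ, true_and] at hz
      simp only [hL, mem_filter, mem_univ, true_and, Function.update_self, Function.update_idem]
      exact hz.1
    · intro z hz
      simp only [hL, mem_filter, mem_univ, true_and] at hz
      simp only [hP, mem_filter, mem_univ, true_and, Function.update_idem, Function.update_self]
      refine ⟨?_, by simp⟩
      have : Function.update z i false = z := by
        rw [← hz.1]; exact Function.update_eq_self i z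
      rw [this]; exact hz.2
    · intro z hz
      simp only [hP, mem_filter, mem_univ, true_and] at hz
      rw [Function.update_idem]
      have hzi : z i = true := by simpa using hz.2
      rw [← hzi]; exact Function.update_eq_self i z
    · intro z hz
      simp only [hL, mem_filter, mem_univ, true_and] at hz
      rw [Function.update_idem, ← hz.1]; exact Function.update_eq_self i z
  rw [← hsplit, h1, h2]; ring

/-- **Total pivotality = twice the number of pivotal UP-edges**:
`Σ_i #{z : G(z|ᵢ₌₀) ≠ G(z|ᵢ₌₁)} = 2 · #upPivotal G`. [folklore] -/
theorem sum_card_piv_eq (G : (κ → Bool) → Bool) :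
    ∑ i, #(univ.filter fun z : κ → Bool => G (Function.update z i false) ≠ G (Function.update z i true)) =
      2 * #(upPivotal G) := by
  simp only [card_piv_eq_two_mul, ← Finset.mul_sum]
  congr 1
  rw [upPivotal, Finset.card_filter, ← Finset.univ_product_univ, Finset.sum_product_right]
  refine Finset.sum_congr rfl fun i _ => ?_
  rw [Finset.card_filter]

/-- Transport of pivotal sets along a renaming of the coordinates. [folklore] -/
theorem card_piv_comp_equiv {κ' : Type} [Fintype κ'] [DecidableEq κ'] (G : (κ → Bool) → Bool)
    (e : κ ≃ κ') (i : κ) :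
    #(univ.filter fun u : κ' → Bool => G (Function.update u (e i) false ∘ e) ≠ G (Function.update u (e i) true ∘ e)) =
      #(univ.filter fun z : κ → Bool => G (Function.update z i false) ≠ G (Function.update z i true)) := by
  refine Finset.card_bij' (fun u _ => u ∘ e) (fun z _ => z ∘ e.symm) ?_ ?_ ?_ ?_
  · intro u hu
    simp only [mem_filter, mem_univ, true_and] at hu ⊢
    rw [Function.update_comp_equiv, Function.update_comp_equiv] at hu
    simpa using hu
  · intro z hz
    simp only [mem_filter, mem_univ, true_and] at hz ⊢
    rw [Function.update_comp_equiv, Function.update_comp_equiv]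
    simpa [Function.comp_assoc] using hz
  · intro u _; ext j; simp
  · intro z _; ext j; simp

/-- `#upPivotal` is invariant under renaming the coordinates. [folklore] -/
theorem card_upPivotal_comp_equiv {κ' : Type} [Fintype κ'] [DecidableEq κ'] (G : (κ → Bool) → Bool)
    (e : κ ≃ κ') : #(upPivotal (fun u : κ' → Bool => G (u ∘ e))) = #(upPivotal G) := by
  have h1 := sum_card_piv_eq (fun u : κ' → Bool => G (u ∘ e))
  have h2 := sum_card_piv_eq G
  rw [← e.sum_comp] at h1
  simp only [card_piv_comp_equiv] at h1
  omega

end Piv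

/-! ### The Fourier identity on `Fin m` -/

section Fourier

variable {m : ℕ}

/-- `(univ.erase i).piecewise β x = β` with coordinate `i` replaced by `x i`. [folklore] -/
theorem piecewise_erase_eq_update (i : Fin m) (β x : Fin m → Bool) :
    (univ.erase i).piecewise β x = Function.update β i (x i) := by
  funext j
  by_cases hj : j = i
  · subst hj
    simp [Finset.piecewise]
  · simp [Finset.piecewise, hj]

/-- Sums over the cube of a function of one coordinate: `Σ_x φ(x i) = Σ_x φ(¬ x i)`. [folklore] -/
theorem sum_apply_coord_eq_sum_not (i : Fin m) (φ : Bool → ℝ) :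
    ∑ x : Fin m → Bool, φ (x i) = ∑ x : Fin m → Bool, φ (!(x i)) := by
  have hinv : Function.Involutive (fun x : Fin m → Bool => Function.update x i (!(x i))) := by
    intro x; funext j; by_cases hj : j = i
    · subst hj; simp
    · simp [hj]
  rw [← Equiv.sum_comp hinv.toPerm (fun x => φ (!(x i)))]
  refine Finset.sum_congr rfl fun x _ => ?_
  simp [Function.Involutive.toPerm]

/-- The level-`≥ 1` Fourier weight of the one-variable function `x ↦ sgn G(β|ᵢ₌ₓᵢ)` is the indicator of
"`i` is pivotal at `β`". [folklore] -/
theorem tailWeight_one_update (G : (Fin m → Bool) → Bool) (i : Fin m) (β : Fin m → Bool) :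
    tailWeight (fun x : Fin m → Bool => sgn (G (Function.update β i (x i)))) 1 =
      if G (Function.update β i false) ≠ G (Function.update β i true) then 1 else 0 := by
  classical
  set h : (Fin m → Bool) → ℝ := fun x => sgn (G (Function.update β i (x i))) with hh
  have hsq : ∀ x, h x ^ 2 = 1 := fun x => by
    rw [hh]; dsimp only; cases G (Function.update β i (x i)) <;> simp
  -- split off the empty set
  have hsplit : tailWeight h 1 = (∑ S, cubeFourierCoeff h S ^ 2) - cubeFourierCoeff h ∅ ^ 2 := by
    rw [tailWeight]
    have : (univ.filter fun S : Finset (Fin m) => 1 ≤ S.card) = univ.erase ∅ := by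
      ext S; simp [Nat.one_le_iff_ne_zero, Finset.card_eq_zero]
    rw [this, Finset.sum_erase_eq_sub (Finset.mem_univ _)]
  rw [hsplit, sum_cubeFourierCoeff_sq, cubeFourierCoeff_empty]
  simp only [hsq, Finset.sum_const, Finset.card_univ, Fintype.card_fun, Fintype.card_bool, Fintype.card_fin,
    nsmul_eq_mul, mul_one, Nat.cast_pow, Nat.cast_ofNat]
  have h2m : (2 : ℝ) ^ m ≠ 0 := by positivity
  rw [div_self h2m]
  -- the mean of `h`
  set φ : Bool → ℝ := fun b => sgn (G (Function.update β i b)) with hφ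
  have hmean : ∑ x : Fin m → Bool, h x = 2 ^ m * ((φ false + φ true) / 2) := by
    have e1 : ∑ x : Fin m → Bool, h x = ∑ x : Fin m → Bool, φ (x i) := rfl
    have e2 := sum_apply_coord_eq_sum_not i φ
    have e3 : ∑ x : Fin m → Bool, (φ (x i) + φ (!(x i))) = 2 ^ m * (φ false + φ true) := by
      have : ∀ x : Fin m → Bool, φ (x i) + φ (!(x i)) = φ false + φ true := by
        intro x; cases x i <;> simp [add_comm]
      simp only [this, Finset.sum_const, Finset.card_univ, Fintype.card_fun, Fintype.card_bool,
        Fintype.card_fin, nsmul_eq_mul, Nat.cast_pow, Nat.cast_ofNat]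
    rw [Finset.sum_add_distrib, ← e2, ← e1] at e3
    linarith
  rw [hmean, mul_div_cancel_left₀ _ h2m]
  by_cases hp : G (Function.update β i false) ≠ G (Function.update β i true)
  · rw [if_pos hp]
    have : φ false + φ true = 0 := by
      rw [hφ]; dsimp only
      revert hp
      cases G (Function.update β i false) <;> cases G (Function.update β i true) <;> simp
    rw [this]; norm_num
  · rw [if_neg hp]
    have heq : G (Function.update β i false) = G (Function.update β i true) := by
      by_contra hne; exact hp hne
    have : ((φ false + φ true) / 2) ^ 2 = 1 := by
      rw [hφ]; dsimp only; rw [heq]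
      cases G (Function.update β i true) <;> norm_num
    rw [this]; norm_num

/-- **Influence of one coordinate in Fourier terms**: `#{β : i pivotal at β} = 2^m Σ_{S ∋ i} ĝ(S)²` for
`g = sgn ∘ G` (O'Donnell 2014, Prop. 3.21 + Parseval in the fixed coordinates). [folklore] -/
theorem card_piv_eq_fourier (G : (Fin m → Bool) → Bool) (i : Fin m) :
    (#(univ.filter fun z : Fin m → Bool => G (Function.update z i false) ≠ G (Function.update z i true)) : ℝ) =
      2 ^ m * ∑ S ∈ univ.filter (fun S : Finset (Fin m) => i ∈ S), cubeFourierCoeff (fun x => sgn (G x)) S ^ 2 := by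
  classical
  have key := sum_tailWeight_piecewise (fun x => sgn (G x)) (univ.erase i) 1
  have hL : ∑ β : Fin m → Bool, tailWeight (fun x => sgn (G ((univ.erase i).piecewise β x))) 1 =
      (#(univ.filter fun z : Fin m → Bool => G (Function.update z i false) ≠ G (Function.update z i true)) : ℝ) := by
    have : ∀ β : Fin m → Bool, tailWeight (fun x => sgn (G ((univ.erase i).piecewise β x))) 1 =
        if G (Function.update β i false) ≠ G (Function.update β i true) then 1 else 0 := by
      intro β
      have := tailWeight_one_update G i β
      simpa only [piecewise_erase_eq_update] using this
    simp only [this]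
    rw [Finset.sum_boole]
  have hR : (univ.filter fun S : Finset (Fin m) => 1 ≤ (S \ univ.erase i).card) =
      univ.filter fun S : Finset (Fin m) => i ∈ S := by
    ext S
    simp only [Finset.mem_filter, Finset.mem_univ, true_and]
    have : S \ univ.erase i = S ∩ {i} := by
      ext j; by_cases hj : j = i <;> simp [hj]
    rw [this, Nat.one_le_iff_ne_zero, Ne, Finset.card_eq_zero, ← Ne, ← Finset.nonempty_iff_ne_empty]
    constructor
    · rintro ⟨j, hj⟩
      rw [Finset.mem_inter, Finset.mem_singleton] at hj
      exact hj.2 ▸ hj.1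
    · intro h; exact ⟨i, Finset.mem_inter.2 ⟨h, Finset.mem_singleton_self i⟩⟩
  rw [hL, hR] at key
  exact key

/-- **Total pivotality in Fourier terms**: `Σ_i #{z : i pivotal at z} = 2^m Σ_S |S| ĝ(S)² = 2^m Σ_{d<m} W^{≥ d+1}[g]`,
`g = sgn ∘ G` (O'Donnell 2014, `I[f] = Σ_k W^{≥k}[f]`). [folklore] -/
theorem sum_card_piv_eq_sum_tailWeight (G : (Fin m → Bool) → Bool) :
    ((∑ i, #(univ.filter fun z : Fin m → Bool =>
        G (Function.update z i false) ≠ G (Function.update z i true)) : ℕ) : ℝ) =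
      2 ^ m * ∑ d ∈ Finset.range m, tailWeight (fun x => sgn (G x)) (d + 1) := by
  classical
  set g : (Fin m → Bool) → ℝ := fun x => sgn (G x) with hg
  have habel := sum_choose_mul_sq_eq_sum_tailWeight g (le_refl 1)
  simp only [Nat.choose_one_right, Nat.sub_self, Nat.choose_zero_right, Nat.cast_one, one_mul] at habel
  rw [← habel, Nat.cast_sum]
  simp only [card_piv_eq_fourier, ← Finset.mul_sum]
  congr 1
  -- `Σ_i Σ_{S ∋ i} F S = Σ_S |S| F S`
  simp only [Finset.sum_filter]
  rw [Finset.sum_comm]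
  refine Finset.sum_congr rfl fun S _ => ?_
  rw [← Finset.sum_filter, Finset.filter_mem_eq_inter, Finset.univ_inter, Finset.sum_const, nsmul_eq_mul]

/-- **Pivotal UP-edges in Fourier terms**: `2 · #upPivotal G = 2^m Σ_{d<m} W^{≥ d+1}[sgn ∘ G]`. [folklore] -/
theorem two_mul_card_upPivotal_eq (G : (Fin m → Bool) → Bool) :
    2 * (#(upPivotal G) : ℝ) = 2 ^ m * ∑ d ∈ Finset.range m, tailWeight (fun x => sgn (G x)) (d + 1) := by
  rw [← sum_card_piv_eq_sum_tailWeight, sum_card_piv_eq]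
  push_cast; ring

end Fourier

/-! ### The bound for shallow circuits -/

section Bound

open ACForm

variable {m : ℕ}

/-- A finite geometric tail: `Σ_{i<m} e^{-(i+1)c} ≤ 1/c` for `c > 0`. [folklore] -/
theorem sum_exp_neg_succ_mul_le {c : ℝ} (hc : 0 < c) (m : ℕ) :
    ∑ i ∈ Finset.range m, Real.exp (-((i + 1 : ℕ) * c)) ≤ 1 / c := by
  set a := Real.exp (-c) with ha
  have ha0 : 0 < a := Real.exp_pos _
  have ha1 : a < 1 := Real.exp_lt_one_iff.2 (by linarith)
  have hterm : ∀ i : ℕ, Real.exp (-((i + 1 : ℕ) * c)) = a ^ (i + 1) := by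
    intro i; rw [ha, ← Real.exp_nat_mul]; congr 1; push_cast; ring
  simp only [hterm]
  have htel : ∀ n : ℕ, (1 - a) * ∑ i ∈ Finset.range n, a ^ (i + 1) = a - a ^ (n + 1) := by
    intro n; induction n with
    | zero => simp
    | succ n ih => rw [Finset.sum_range_succ, mul_add, ih]; ring
  have hle : (1 - a) * ∑ i ∈ Finset.range m, a ^ (i + 1) ≤ a := by
    rw [htel]; linarith [pow_pos ha0 (m + 1)]
  have h1a : 0 < 1 - a := by linarith
  have hsum : ∑ i ∈ Finset.range m, a ^ (i + 1) ≤ a / (1 - a) := by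
    rw [le_div_iff₀ h1a]; linarith
  refine hsum.trans ?_
  -- `a/(1-a) = 1/(e^c - 1) ≤ 1/c`
  have hexp : a * Real.exp c = 1 := by rw [ha, ← Real.exp_add]; simp
  have hec : c + 1 ≤ Real.exp c := Real.add_one_le_exp c
  rw [div_le_div_iff₀ h1a hc]
  nlinarith [mul_pos ha0 hc]

/-- **Total pivotality of a shallow circuit** (Boppana / Linial–Mansour–Nisan / Tal): for a circuit over `acBasis`
on `Fin m` of `acDepth ≤ d` and at most `s ≥ 1` gates,
`2 · #upPivotal ≤ 2^m · A^{d+2} B^{d+2} ℓ^d / log 2` with `ℓ = logM (2s)`, `A = cA`, `B = cB`.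
[cite: Tal2017, Theorem 3.6; Boppana1997] -/
theorem two_mul_card_upPivotal_circuit_le (C : Circuit (Fin m)) (hC : C.IsOver acBasis) {d s : ℕ}
    (hd : C.acDepth ≤ d) (hs : C.size ≤ s) (h1 : 1 ≤ s) :
    2 * (#(upPivotal C.eval) : ℝ) ≤
      2 ^ m * ((cA : ℝ) ^ (d + 2) * (cB : ℝ) ^ (d + 2) * (logM (2 * s) : ℝ) ^ d / Real.log 2) := by
  obtain ⟨f, hev, hh, hw, hsize⟩ := C.exists_acForm hC
  have hM : 1 ≤ 2 * s := by omega
  have hℓ := one_le_logM hM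
  have htail : ∀ k, tailWeight (fun x => sgn (C.eval x)) k ≤ tailBound (logM (2 * s)) (d + 2) 1 k := by
    intro k
    have := tailWeight_le_tailBound (n := m) hM (d + 2) (by omega) f 1 le_rfl hℓ (by omega)
      (hsize.trans (by omega)) hw k
    have hfun : (fun x => sgn (C.eval x)) = sgnEval f := by funext x; rw [sgnEval, hev]
    rw [hfun]; exact this
  rw [two_mul_card_upPivotal_eq]
  refine mul_le_mul_of_nonneg_left ?_ (by positivity)
  -- sum the tail bounds geometrically
  set ℓ : ℝ := (logM (2 * s) : ℝ) with hℓdef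
  have hℓ1 : (1 : ℝ) ≤ ℓ := by rw [hℓdef]; exact_mod_cast hℓ
  set c : ℝ := Real.log 2 / ((cB : ℝ) ^ (d + 2) * 1 * ℓ ^ (d + 2 - 2)) with hcdef
  have hB : (0 : ℝ) < cB := by unfold cB B0; norm_num
  have hA : (0 : ℝ) < cA := by unfold cA; norm_num
  have hl2 := Real.log_pos (by norm_num : (1 : ℝ) < 2)
  have hden : 0 < (cB : ℝ) ^ (d + 2) * 1 * ℓ ^ (d + 2 - 2) := by
    have : (0 : ℝ) < ℓ ^ (d + 2 - 2) := pow_pos (by linarith) _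
    positivity
  have hc : 0 < c := div_pos hl2 hden
  have hbound : ∀ k : ℕ, tailBound (logM (2 * s)) (d + 2) 1 k = (cA : ℝ) ^ (d + 2) * Real.exp (-(k * c)) := by
    intro k
    rw [tailBound, hcdef, hℓdef]
    congr 2
    simp only [Nat.cast_one]
    ring
  calc ∑ i ∈ Finset.range m, tailWeight (fun x => sgn (C.eval x)) (i + 1)
      ≤ ∑ i ∈ Finset.range m, (cA : ℝ) ^ (d + 2) * Real.exp (-((i + 1 : ℕ) * c)) :=
        Finset.sum_le_sum fun i _ => by rw [← hbound]; exact_mod_cast htail (i + 1)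
    _ = (cA : ℝ) ^ (d + 2) * ∑ i ∈ Finset.range m, Real.exp (-((i + 1 : ℕ) * c)) := by
        rw [Finset.mul_sum]
    _ ≤ (cA : ℝ) ^ (d + 2) * (1 / c) :=
        mul_le_mul_of_nonneg_left (sum_exp_neg_succ_mul_le hc m) (by positivity)
    _ = (cA : ℝ) ^ (d + 2) * (cB : ℝ) ^ (d + 2) * (logM (2 * s) : ℝ) ^ d / Real.log 2 := by
        rw [hcdef, hℓdef, show d + 2 - 2 = d by omega]
        field_simp

end Bound

/-! ### Restrictions to sub-cubes on an arbitrary finite cube -/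

section Restrict

variable {ι : Type} [Fintype ι] [DecidableEq ι]

/-- **Total pivotality of the restriction of a shallow circuit to a sub-cube**: for `D` over `acBasis` of
`acDepth ≤ d`, `size ≤ s` (`d, s ≥ 1`) and every `T`, the restricted function `y ↦ D(y ∧ 1_T)` has
`2 · #upPivotal ≤ 2^N · A^{d+2} B^{d+2} ℓ^d / log 2` (restrictions and renamings of inputs keep size and depth:
`Circuit.exists_restrict`, `Circuit.mapInputs`). [cite: Tal2017, Theorem 3.6; Hastad1986, §2] -/
theorem two_mul_card_upPivotal_restrict_le (D : Circuit ι) (hD : D.IsOver acBasis) {d s : ℕ}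
    (hd : D.acDepth ≤ d) (hs : D.size ≤ s) (hd1 : 1 ≤ d) (hs1 : 1 ≤ s) (T : Finset ι) :
    2 * (#(upPivotal (fun y : ι → Bool => D.eval (fun e => if e ∈ T then y e else false))) : ℝ) ≤
      2 ^ Fintype.card ι *
        ((ACForm.cA : ℝ) ^ (d + 2) * (ACForm.cB : ℝ) ^ (d + 2) * (ACForm.logM (2 * s) : ℝ) ^ d / Real.log 2) := by
  obtain ⟨C', hC'B, hC's, hC'd, hC'e⟩ := D.exists_restrict hD (fun e => if e ∈ T then none else some false)
  set m := Fintype.card ι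
  set eqv : ι ≃ Fin m := Fintype.equivFin ι
  set C'' : Circuit (Fin m) := C'.mapInputs eqv with hC''
  have h1 : (fun y : ι → Bool => D.eval (fun e => if e ∈ T then y e else false)) =
      fun y : ι → Bool => C''.eval (y ∘ eqv.symm) := by
    funext y
    rw [hC'', Circuit.eval_mapInputs, hC'e]
    congr 1; funext e; by_cases he : e ∈ T <;> simp [restrictInput, he]
  have h2 : #(upPivotal (fun y : ι → Bool => C''.eval (y ∘ eqv.symm))) = #(upPivotal C''.eval) :=
    card_upPivotal_comp_equiv C''.eval eqv.symm
  rw [h1, h2]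
  refine two_mul_card_upPivotal_circuit_le C'' (hC'B.mapInputs _) ?_ ?_ hs1
  · rw [hC'', Circuit.acDepth_mapInputs]; exact hC'd.trans (max_le hd hd1)
  · rw [hC'', Circuit.size_mapInputs]; exact hC's.trans (max_le hs hs1)

/-- **Registered form** (sub-goal `upPivotal_restrict_bound` of stmt-PneNP-14083): the pivotality bound for
sub-cube restrictions of shallow circuits, all binders explicit. [cite: Tal2017, Theorem 3.6] -/
theorem upPivotal_restrict_bound :
    ∀ (ι : Type) [Fintype ι] [DecidableEq ι] (D : Circuit ι), D.IsOver acBasis → ∀ (d s : ℕ), D.acDepth ≤ d →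
      D.size ≤ s → 1 ≤ d → 1 ≤ s → ∀ T : Finset ι,
        2 * (#(upPivotal (fun y : ι → Bool => D.eval (fun e => if e ∈ T then y e else false))) : ℝ) ≤
          2 ^ Fintype.card ι * ((ACForm.cA : ℝ) ^ (d + 2) * (ACForm.cB : ℝ) ^ (d + 2) *
            (ACForm.logM (2 * s) : ℝ) ^ d / Real.log 2) :=
  fun _ _ _ D hD _ _ hd hs hd1 hs1 T => two_mul_card_upPivotal_restrict_le D hD hd hs hd1 hs1 T

end Restrict

end Summit.PneNP.PneNP.Theorems.ShallowSliceBound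

end
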